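import Literature.AlgebraicGeometry.Motives.SecOfForm
import Literature.AlgebraicGeometry.Motives.GeneratingSectionsOfHomAppLE
import Literature.AlgebraicGeometry.Motives.ToProjFunctionField
import HarnessLib

/-!
# The ratios of `ofHom (D.toProj f)`; surjective chart ring maps of `ofHom r` for a closed immersion `r`

Topic `Literature/AlgebraicGeometry/Motives`; theorem-only companion of
`Motives/MorphismsToProjectiveSpace` (Hartshorne II Thm. 7.1 in chart form, `GeneratingSections`),
`Motives/ProjectiveOfGeneratingSections` (`GeneratingSections.ofHom`) and
`Motives/GeneratingSectionsOfHomAppLE`: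

* `GeneratingSections.chartLift_toProj`, `GeneratingSections.homRatio_toProj` — for ANY
  generating-sections data `D` on `Y` and the morphism `D.toProj f : Y → ℙ(ι)_k` it defines, the
  data `ofHom (D.toProj f)` has the ratios of `D`: `toProj^*(x_b/x_a) = s_b/s_a` on
  `toProj⁻¹D₊(x_a) = Y_{s_a}` (Hartshorne II Thm. 7.1 (b): "`sᵢ = φ^*(xᵢ)`"), for an arbitrary index
  type `ι` and base ring `k` (the tree's `GeneratingSections.ratioFn_ofHom_toProj` is the same
  identity in `K(Y)` for `Y` integral and `ι = Fin (d + 1)`);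
* `GeneratingSections.sectionsRingHom_ofHom_eq_appLE` — the chart ring map
  `(k[x]_{(xᵢ)})₀ → Γ(Y, r⁻¹D₊(xᵢ))` of `ofHom r` is `c ↦ r^*(c)` (Mathlib `Proj.awayToSection`);
* `GeneratingSections.sectionsRingHom_ofHom_surjective`, `closure_ofHom_eq_top` — **for a closed
  immersion `r : Y → ℙ(ι)_k` these chart ring maps are surjective**, i.e. `Γ(Y, r⁻¹D₊(xᵢ))` is
  generated by `k` and the `r^*(x_j/xᵢ)` (hypothesis (2) of Hartshorne II Prop. 7.2 for `r`).

## References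

* R. Hartshorne, *Algebraic Geometry*, GTM 52 (1977): II Thm. 7.1, II Prop. 7.2. [Hartshorne1977]
-/

universe u

open CategoryTheory AlgebraicGeometry Limits HomogeneousLocalization TopologicalSpace Opposite
open MvPolynomial (X C eval₂Hom eval₂)
open Literature.AlgebraicGeometry.Motives.Segre

attribute [local instance] MvPolynomial.gradedAlgebra

noncomputable section

namespace Literature.AlgebraicGeometry.Motives

namespace GeneratingSections

/-! ### The ratios of `ofHom (D.toProj f)` are the ratios of `D` -/

section OfHomToProj

variable {ι : Type} {k : Type u} [CommRing k] {Y : Scheme.{u}} (D : GeneratingSections ι Y)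
  (f : Y ⟶ Spec (.of k))

/-- The chart lift `toProj⁻¹D₊(x_a) → Spec (k[x]_{(x_a)})₀` of the morphism defined by generating
sections is `Spec` of the chart ring map `x_b/x_a ↦ s_b/s_a` (both lift `toProj⁻¹D₊(x_a) → Y → ℙ(ι)`
through the open immersion `D₊(x_a) ↪ ℙ(ι)`; `GeneratingSections.comp_toProj`).
[cite: Hartshorne1977, II Thm. 7.1 (b)] -/
theorem chartLift_toProj (a : ι) :
    chartLift (D.toProj f) a = Scheme.toSpecΓ (preU (D.toProj f) a) ≫ Spec.map (CommRingCat.ofHom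
      (D.chartRingHom f a (preU (D.toProj f) a).ι
        (top_le_ι_preimage_of_le (D.toProj_preimage_basicOpen f a).le))) := by
  refine (IsOpenImmersion.lift_uniq _ _ _ _ ?_).symm
  rw [Category.assoc]
  exact (D.comp_toProj f _ (top_le_ι_preimage_of_le (D.toProj_preimage_basicOpen f a).le)).symm

/-- **`ofHom (D.toProj f)` recovers the ratios of `D`**: `toProj^*(x_b/x_a) = s_b/s_a` on
`toProj⁻¹D₊(x_a) = U a` (Hartshorne II Thm. 7.1 (b): "`sᵢ = φ^*(xᵢ)`").
[cite: Hartshorne1977, II Thm. 7.1 (b)] -/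
theorem homRatio_toProj (a b : ι) :
    homRatio (D.toProj f) a b =
      Y.presheaf.map (homOfLE (D.toProj_preimage_basicOpen f a).le).op (D.ratio a b) := by
  rw [homRatio, chartLift_toProj, pull_SpecMap, pull_toSpecΓ]
  change (preU (D.toProj f) a).topIso.hom (D.chartRingHom f a (preU (D.toProj f) a).ι
    (top_le_ι_preimage_of_le (D.toProj_preimage_basicOpen f a).le) (frac k a b)) = _
  rw [chartRingHom_frac]
  exact topIso_hom_res _ _

/-- The same, in the restriction notation `rs` of `Motives/ProjectiveOfGeneratingSections`:
`toProj^*(x_b/x_a) = s_b/s_a`. [cite: Hartshorne1977, II Thm. 7.1 (b)] -/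
theorem ofHom_toProj_ratio (a b : ι) :
    (ofHom (D.toProj f)).ratio a b = rs (D.toProj_preimage_basicOpen f a).le (D.ratio a b) :=
  D.homRatio_toProj f a b

end OfHomToProj

/-! ### The chart ring maps of `ofHom r` for a closed immersion `r` are surjective -/

section OfHomSurjective

variable {ι : Type} {k : Type u} [CommRing k] {Y : Scheme.{u}} (f : Y ⟶ Spec (.of k))
  (r : Y ⟶ Proj (grading ι k)) (hr : r ≫ toSpec ι k = f)

include hr in
/-- The chart ring map `(k[x]_{(xᵢ)})₀ → Γ(Y, r⁻¹D₊(xᵢ))` of `ofHom r` is `c ↦ r^*(c)`, the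
section `c` over `D₊(xᵢ)` (Mathlib `Proj.awayToSection`) pulled back along `r`.
[cite: Hartshorne1977, II Thm. 7.1 (a)] -/
theorem sectionsRingHom_ofHom_eq_appLE (i : ι) (c : Away (grading ι k) (X i)) :
    (ofHom r).sectionsRingHom f i c = r.appLE (Proj.basicOpen (grading ι k) (X i)) (preU r i) le_rfl
      (Proj.awayToSection (grading ι k) (X i) c) := by
  obtain ⟨n, F, hF, rfl⟩ := Away.mk_surjective (grading ι k) (X_mem k i) c
  rw [sectionsRingHom_awayMk, sectionsFun_ofHom_eq f r hr i F hF, ← topIso_hom_pull_chartLift]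

include hr in
/-- **For a closed immersion `r : Y → ℙ(ι)` the chart ring maps of `ofHom r` are surjective**:
`Γ(Y, r⁻¹D₊(xᵢ))` is generated by `k` and the `r^*(x_j/xᵢ)` (`r^*` is onto over the affine
`D₊(xᵢ)`, Mathlib `Scheme.Hom.app_surjective`, and `(k[x]_{(xᵢ)})₀ ≅ Γ(ℙ(ι), D₊(xᵢ))`,
Mathlib `Proj.basicOpenIsoAway`). [cite: Hartshorne1977, II Prop. 7.2] -/
theorem sectionsRingHom_ofHom_surjective [IsClosedImmersion r] (i : ι) :
    Function.Surjective ((ofHom r).sectionsRingHom f i) := by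
  have h1 : Function.Surjective (r.app (Proj.basicOpen (grading ι k) (X i))) :=
    r.app_surjective _ (Proj.isAffineOpen_basicOpen _ _ (X_mem k i) zero_lt_one)
  have h2 : Function.Surjective (Proj.awayToSection (grading ι k) (X i)) := by
    rw [← Proj.basicOpenIsoAway_hom (grading ι k) (X i) (X_mem k i) zero_lt_one]
    exact (ConcreteCategory.bijective_of_isIso
      (Proj.basicOpenIsoAway (grading ι k) (X i) (X_mem k i) zero_lt_one).hom).2
  intro s
  obtain ⟨t, rfl⟩ := h1 s
  obtain ⟨c, rfl⟩ := h2 t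
  refine ⟨c, ?_⟩
  rw [sectionsRingHom_ofHom_eq_appLE f r hr, Scheme.Hom.app_eq_appLE]

include hr in
/-- Hence `Γ(Y, r⁻¹D₊(xᵢ))` is the subring generated by the constants and the `r^*(x_j/xᵢ)`.
[cite: Hartshorne1977, II Prop. 7.2] -/
theorem closure_ofHom_eq_top [IsClosedImmersion r] (i : ι) :
    Subring.closure (Set.range ((ofHom r).cstr f i) ∪ Set.range ((ofHom r).ratio i)) = ⊤ := by
  rw [← range_sectionsRingHom, RingHom.range_eq_top]
  exact sectionsRingHom_ofHom_surjective f r hr i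

end OfHomSurjective

end GeneratingSections

end Literature.AlgebraicGeometry.Motives

end
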